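import Summits.ValiantsHypothesis.ValiantsHypothesis.Theorems.MonotoneRestorationOrbitRestorationQPPatternUnfolding
import Summits.ValiantsHypothesis.ValiantsHypothesis.Theorems.MonotoneRestorationOrbitRestorationQPTermCircuitOrbit
import HarnessLib

/-!
# Closed pattern expressions have square-symmetric circuits of orbit size `(n+1)^(k+l+2)` — whatever their length

Route MonotoneRestoration, crux `OrbitRestorationQP` (stmt-ValiantsHypothesis-18293) — K3, namespace
`Summit.ValiantsHypothesis.ValiantsHypothesis.Theorems.PatternClose`.

**Theorem** (`exists_symmetric_close_orbitSize_le`).  For every `n`, every labelled pattern expression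
`e` with `k` row and `l` column labels over a commutative semiring of characteristic `0` — of ANY length —
the closed polynomial `e.close n = Σ_{ρ,γ} value n e ρ γ` is computed by a square-symmetric
Dawar–Wilsenach labelled arithmetic circuit (diagonal action of `Sym(Fin n)`) whose orbit size `ORB`
(largest orbit of a gate under ALL automorphisms, §3.3) is at most `(n+1)^(k+l+2)`.

This is the converse ("easy") direction of the support theorems in ORBIT currency and LENGTH-FREE form
(Dawar–Pago–Seppelt 2025, §5: "for every tuple `v ∈ [n]^ℓ` a gate which computes `F(v)`" — here made
rigorous for Dawar–Wilsenach's automorphism-based `ORB`).  The naive circuit with one gate per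
(position in `e`, assignment) does NOT achieve it: its automorphism group contains the automorphisms of
the syntax tree of `e`, so its orbits grow with the length of `e`.  The circuit used here is the REDUCED
term circuit (`…MonotoneRestorationOrbitRestorationQPTermCircuit*.lean`) of the universe of NORMAL unfoldings of `e`
(`…MonotoneRestorationOrbitRestorationQPPatternUnfolding.lean`): one gate per hereditarily AC-distinct sub-computation, multiplicities
through the gadgets `Sc`/`Pl`/`Zr`; it is rigid, so its orbits are indexed by label assignments
(`≤ n^(k+l)`; variables `≤ n²`).

* `rootTerm`, `subTerms`, `univ` — the universe (`n ≥ 1`): the normal unfoldings of all sub-expressions at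
  all assignments plus the root `Σ_{assignments} unfold e`; `val_rootTerm` (`= close n e`), `act_rootTerm`,
  `univ_stable`, `ncard_orbit_term_le`;
* `exists_symmetric_close_orbitSize_le` — the theorem (`n = 0`: a constant, one gate).

Consumer: route MonotoneRestoration of summit ValiantsHypothesis, crux `OrbitRestorationQP`
(stmt-ValiantsHypothesis-18293), stub `stub_close_orbit` of line `narrow-expansion`
(`orbitRestorationQP_of_narrowExpansion`).  Everything is proved. [folklore]

## References
* A. Dawar, B. Pago, T. Seppelt, *Symmetric algebraic circuits and homomorphism polynomials*,
  arXiv:2502.06740 (2025), §5 (proof of Thm 5.3). [DawarPagoSeppelt2025]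
* A. Dawar, G. Wilsenach, *Symmetric arithmetic circuits*, ToC 21 (2025), Defs. 2.2, 3.6, 3.7, §3.3.
  [DawarWilsenach2025]
-/

noncomputable section

open scoped Classical

-- `Summit.ValiantsHypothesis.ValiantsHypothesis.…` is the tree's single-conjunct layout (Sub = Summit).
set_option linter.dupNamespace false

namespace Summit.ValiantsHypothesis.ValiantsHypothesis.Theorems

open Literature.Computability.AlgebraicComplexity

namespace PatternClose

open PatternExpr (value close value_sumRow value_sumCol value_add value_mul value_edge value_const)

open HTerm TermCircuit

variable {R : Type} [CommSemiring R] {k l : ℕ}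

/-! ### The universe of a closed pattern expression (`n ≥ 1`) -/

section Univ

variable (n : ℕ) (e : PatternExpr R k l)

/-- Label assignments. [folklore] -/
abbrev Asg (n k l : ℕ) : Type := (Fin k → Fin n) × (Fin l → Fin n)

/-- The root term: the sum of the unfoldings over all assignments, normalised (its value is
`close n e`). [folklore] -/
def rootTerm : HTerm R (Fin n × Fin n) :=
  normalize (HTerm.node false ((Finset.univ : Finset (Asg n k l)).toList.map fun a => unfold n e a.1 a.2))

/-- The normal unfoldings of all sub-expressions at all assignments. [folklore] -/
def subTerms : Finset (HTerm R (Fin n × Fin n)) :=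
  (subexprs e).toFinset.biUnion fun s => Finset.univ.image fun a : Asg n k l => nf n s a.1 a.2

omit [CommSemiring R] in
/-- Membership in `subTerms`. [folklore] -/
theorem mem_subTerms {t : HTerm R (Fin n × Fin n)} :
    t ∈ subTerms n e ↔ ∃ s ∈ subexprs e, ∃ (ρ : Fin k → Fin n) (γ : Fin l → Fin n), t = nf n s ρ γ := by
  simp only [subTerms, Finset.mem_biUnion, List.mem_toFinset, Finset.mem_image, Finset.mem_univ,
    true_and, Prod.exists]
  constructor
  · rintro ⟨s, hs, ρ, γ, h⟩; exact ⟨s, hs, ρ, γ, h.symm⟩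
  · rintro ⟨s, hs, ρ, γ, h⟩; exact ⟨s, hs, ρ, γ, h.symm⟩

omit [CommSemiring R] in
/-- The root term, unfolded one level. [folklore] -/
theorem rootTerm_eq : rootTerm n e =
    HTerm.node false (tsort ((Finset.univ : Finset (Asg n k l)).toList.map fun a => nf n e a.1 a.2)) := by
  rw [rootTerm, normalize_node, List.map_map]
  rfl

/-- **The root computes the closed polynomial.** [folklore] -/
theorem val_rootTerm : (rootTerm n e).val = e.close n := by
  rw [rootTerm, val_normalize, val_node_false, List.map_map, Finset.sum_map_toList, PatternExpr.close,
    ← Finset.univ_product_univ, Finset.sum_product]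
  exact Finset.sum_congr rfl fun ρ _ => Finset.sum_congr rfl fun γ _ => val_unfold n e ρ γ

omit [CommSemiring R] in
/-- The root is fixed by the action. [folklore] -/
theorem act_rootTerm (σ : Equiv.Perm (Fin n)) : act σ (rootTerm n e) = rootTerm n e := by
  rw [rootTerm, act_normalize, act_node, normalize_node, List.map_map, List.map_map]
  congr 1
  apply tsort_eq_of_perm
  have h1 : (Finset.univ : Finset (Asg n k l)).toList.map (act σ ∘ fun a => unfold n e a.1 a.2) =
      ((Finset.univ : Finset (Asg n k l)).toList.map fun a => σ • a).map
        (normalize ∘ fun a => unfold n e a.1 a.2) := by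
    rw [List.map_map]
    refine List.map_congr_left fun a _ => ?_
    simp only [Function.comp, act]
    exact normalize_rename_unfold n σ e a.1 a.2
  rw [h1]
  refine List.Perm.map _ (List.perm_of_nodup_nodup_toFinset_eq ?_ (Finset.nodup_toList _) ?_)
  · exact (Finset.nodup_toList _).map (MulAction.injective σ)
  · rw [show (((Finset.univ : Finset (Asg n k l)).toList.map fun a => σ • a).toFinset) =
        (Finset.univ : Finset (Asg n k l)).image (fun a => σ • a) from by ext x; simp [List.mem_toFinset],
      Finset.toList_toFinset]
    exact Finset.image_univ_of_surjective (MulAction.surjective σ)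

variable [NeZero n]

/-- **The universe of a closed pattern expression** (for `n ≥ 1`). [folklore] -/
def univ : TermCircuit.Universe R (Fin n × Fin n) where
  T := insert (rootTerm n e) (subTerms n e)
  M := n ^ (k + l) + n + 2
  root := rootTerm n e
  normal := by
    intro t ht
    rcases Finset.mem_insert.1 ht with rfl | ht
    · exact normalize_normalize _
    · obtain ⟨s, _, ρ, γ, rfl⟩ := (mem_subTerms n e).1 ht
      exact normalize_nf n s ρ γ
  closed := by
    intro b L hL u hu
    refine Finset.mem_insert_of_mem ((mem_subTerms n e).2 ?_)
    rcases Finset.mem_insert.1 hL with h | h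
    · rw [rootTerm_eq] at h
      simp only [HTerm.node.injEq] at h
      rw [h.2] at hu
      have hu' := (tsort_perm _).subset hu
      rw [List.mem_map] at hu'
      obtain ⟨a, _, rfl⟩ := hu'
      exact ⟨e, self_mem_subexprs e, a.1, a.2, rfl⟩
    · obtain ⟨s, hs, ρ, γ, hsu⟩ := (mem_subTerms n e).1 h
      obtain ⟨s', hs', ρ', γ', rfl⟩ := exists_of_mem_nf_children n s ρ γ hsu.symm hu
      exact ⟨s', subexprs_trans hs hs', ρ', γ', rfl⟩
  binary := by
    intro L hL
    rcases Finset.mem_insert.1 hL with h | h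
    · rw [rootTerm_eq] at h; simp at h
    · obtain ⟨s, _, ρ, γ, hsu⟩ := (mem_subTerms n e).1 h
      exact length_eq_two_of_nf_eq_node_true n s ρ γ hsu.symm
  nonempty := by
    intro L hL
    have hn : 0 < n := Nat.pos_of_ne_zero (NeZero.ne n)
    rcases Finset.mem_insert.1 hL with h | h
    · rw [rootTerm_eq] at h
      simp only [HTerm.node.injEq, true_and] at h
      rw [h, ← List.length_pos_iff_ne_nil, (tsort_perm _).length_eq, List.length_map,
        Finset.length_toList, Finset.card_univ]
      exact Fintype.card_pos
    · obtain ⟨s, _, ρ, γ, hsu⟩ := (mem_subTerms n e).1 h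
      rw [← List.length_pos_iff_ne_nil]
      rcases length_of_nf_eq_node_false n s ρ γ hsu.symm with h2 | h2 <;> omega
  count_le := by
    intro L hL u
    refine (List.count_le_length).trans ?_
    rcases Finset.mem_insert.1 hL with h | h
    · rw [rootTerm_eq] at h
      simp only [HTerm.node.injEq, true_and] at h
      rw [h, (tsort_perm _).length_eq, List.length_map, Finset.length_toList, Finset.card_univ]
      simp only [Fintype.card_prod, Fintype.card_pi, Fintype.card_fin, Finset.prod_const,
        Finset.card_univ, pow_add]
      omega
    · obtain ⟨s, _, ρ, γ, hsu⟩ := (mem_subTerms n e).1 h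
      rcases length_of_nf_eq_node_false n s ρ γ hsu.symm with h2 | h2 <;> omega
  one_le := by omega
  root_mem := Finset.mem_insert_self _ _
  root_node := ⟨false, _, rootTerm_eq n e⟩

omit [CommSemiring R] in
/-- The universe is stable under the diagonal action of `Sym(Fin n)`. [folklore] -/
theorem univ_stable : ∀ (σ : Equiv.Perm (Fin n)) (t : HTerm R (Fin n × Fin n)),
    t ∈ (univ n e).T → act σ t ∈ (univ n e).T := by
  intro σ t ht
  change t ∈ insert (rootTerm n e) (subTerms n e) at ht
  change act σ t ∈ insert (rootTerm n e) (subTerms n e)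
  rcases Finset.mem_insert.1 ht with rfl | ht
  · rw [act_rootTerm]; exact Finset.mem_insert_self _ _
  · obtain ⟨s, hs, ρ, γ, rfl⟩ := (mem_subTerms n e).1 ht
    rw [act_nf]
    exact Finset.mem_insert_of_mem ((mem_subTerms n e).2 ⟨s, hs, _, _, rfl⟩)

omit [NeZero n] in
/-- A range over a finite domain is no larger than the domain. [folklore] -/
theorem ncard_range_le_card {α β : Type*} [Fintype α] (f : α → β) :
    (Set.range f).ncard ≤ Fintype.card α := by
  rw [← Set.image_univ, ← Nat.card_eq_fintype_card, ← Set.ncard_univ]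
  exact Set.ncard_image_le (Set.toFinite _)

omit [NeZero n] in
/-- A range into a finite codomain is no larger than the codomain. [folklore] -/
theorem ncard_range_le_card_cod {α β : Type*} [Fintype β] (f : α → β) :
    (Set.range f).ncard ≤ Fintype.card β := by
  rw [← Nat.card_eq_fintype_card, ← Set.ncard_univ]
  exact Set.ncard_le_ncard (Set.subset_univ _) (Set.toFinite _)

omit [CommSemiring R] in
/-- Orbits of member terms are bounded by the number of assignments. [folklore] -/
theorem ncard_orbit_term_le {t : HTerm R (Fin n × Fin n)} (ht : t ∈ (univ n e).T) :
    (Set.range fun σ : Equiv.Perm (Fin n) => act σ t).ncard ≤ n * n + n ^ (k + l) := by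
  change t ∈ insert (rootTerm n e) (subTerms n e) at ht
  rcases Finset.mem_insert.1 ht with rfl | ht
  · simp only [act_rootTerm]
    rw [Set.range_const, Set.ncard_singleton]
    have : 1 ≤ n * n := Nat.one_le_iff_ne_zero.2 (by simp [NeZero.ne n])
    omega
  · obtain ⟨s, _, ρ, γ, rfl⟩ := (mem_subTerms n e).1 ht
    simp only [act_nf]
    refine le_trans ?_ (Nat.le_add_left _ _)
    have hsub : (Set.range fun σ : Equiv.Perm (Fin n) => nf n s (σ • ρ) (σ • γ)) ⊆
        Set.range fun a : Asg n k l => nf n s a.1 a.2 := by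
      rintro _ ⟨σ, rfl⟩; exact ⟨(σ • ρ, σ • γ), rfl⟩
    refine (Set.ncard_le_ncard hsub (Set.toFinite _)).trans ((ncard_range_le_card _).trans ?_)
    simp [Fintype.card_prod, Fintype.card_fin, pow_add]

end Univ

/-! ### The length-free orbit bound -/

/-- A constant is computed by a one-gate symmetric circuit (orbit size `≤ 1`). [folklore] -/
theorem exists_symmetric_const_orbit {X Γ : Type} [Group Γ] [MulAction Γ X] [MulAction Γ Unit] (c : R) :
    ∃ (G : Type) (_ : Fintype G) (C : LabelledArithCircuit R X Unit G),
      C.IsSymmetric Γ ∧ C.eval (C.output ()) = MvPolynomial.C c ∧ C.orbitSize Γ ≤ 1 := by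
  let C : LabelledArithCircuit R X Unit Unit :=
    { children := fun _ => ∅, label := fun _ => .const c, output := fun _ => (),
      wf := ⟨fun u => Acc.intro u fun v hv => absurd hv (Finset.notMem_empty v)⟩,
      isInput_iff := fun _ => by simp,
      eq_of_label_eq := fun u v _ _ => Subsingleton.elim u v,
      output_injective := fun u v _ => Subsingleton.elim u v }
  refine ⟨Unit, inferInstance, C, fun γ => ⟨1, ⟨fun _ => by simp [C], fun _ => rfl, fun _ => rfl⟩⟩,
    C.eval_of_label_const rfl, (C.orbitSize_le_size Γ).trans (by simp [LabelledArithCircuit.size])⟩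

/-- Arithmetic: `n² + n^(k+l) ≤ (n+1)^(k+l+2)`. [folklore] -/
theorem orbit_bound_arith (n k l : ℕ) : n * n + n ^ (k + l) ≤ (n + 1) ^ (k + l + 2) := by
  have h1 : n ^ (k + l) ≤ (n + 1) ^ (k + l) := Nat.pow_le_pow_left (Nat.le_succ n) _
  have h2 : 1 ≤ (n + 1) ^ (k + l) := Nat.one_le_pow _ _ (Nat.succ_pos n)
  have h3 : (n + 1) ^ (k + l + 2) = (n + 1) ^ (k + l) * ((n + 1) * (n + 1)) := by ring
  nlinarith

/-- **THE LENGTH-FREE ORBIT BOUND FOR CLOSED PATTERN EXPRESSIONS.** For every `n`, every labelled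
pattern expression `e` with `k` row and `l` column labels — of ANY length — over a commutative semiring of
characteristic `0`, the closed polynomial `e.close n = Σ_{ρ,γ} value n e ρ γ` is computed by a
square-symmetric labelled arithmetic circuit (diagonal action of `Sym(Fin n)`) all of whose
Dawar–Wilsenach orbits — over ALL automorphisms — have at most `(n+1)^(k+l+2)` gates.  The circuit is the
REDUCED term circuit of the universe of normal unfoldings of `e` (one gate per hereditarily AC-distinct
sub-computation, multiplicities through the gadgets `Sc`/`Pl`/`Zr`); it is rigid, so its orbits are the
designed ones, which are indexed by label assignments.  (A position-indexed circuit would not do: its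
automorphism group contains the automorphisms of the syntax tree of `e`, so its orbits grow with the length
of `e`.) [folklore] -/
theorem exists_symmetric_close_orbitSize_le [CharZero R] (n k l : ℕ) (e : PatternExpr R k l) :
    ∃ (G : Type) (_ : Fintype G) (C : LabelledArithCircuit R (Fin n × Fin n) Unit G),
      C.IsSymmetric (Equiv.Perm (Fin n)) ∧ C.eval (C.output ()) = e.close n ∧
        C.orbitSize (Equiv.Perm (Fin n)) ≤ (n + 1) ^ (k + l + 2) := by
  classical
  rcases Nat.eq_zero_or_pos n with rfl | hn
  · -- `n = 0`: no variables, the closed polynomial is a constant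
    obtain ⟨G, inst, C, hC, hev, horb⟩ := exists_symmetric_const_orbit (X := Fin 0 × Fin 0)
      (Γ := Equiv.Perm (Fin 0)) (MvPolynomial.coeff 0 (e.close 0))
    refine ⟨G, inst, C, hC, ?_, horb.trans (Nat.one_le_pow _ _ (by omega))⟩
    rw [hev]
    exact (MvPolynomial.eq_C_of_isEmpty _).symm
  · haveI : NeZero n := ⟨by omega⟩
    have hB : 1 ≤ n * n + n ^ (k + l) := le_add_right (Nat.mul_pos hn hn)
    obtain ⟨G, inst, C, hC, hev, horb⟩ := TermCircuit.exists_symmetric_orbitSize_le (univ n e)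
      (univ_stable n e) (act_rootTerm n e) (n * n + n ^ (k + l)) hB
      (fun x => (ncard_range_le_card_cod _).trans (by simp))
      (fun t ht => ncard_orbit_term_le n e ht)
    exact ⟨G, inst, C, hC, hev.trans (val_rootTerm n e), horb.trans (orbit_bound_arith n k l)⟩

end PatternClose

/-- **Stub `stub_close_orbit` of line `narrow-expansion` (crux `OrbitRestorationQP`,
stmt-ValiantsHypothesis-18293), verbatim** — the LENGTH-FREE ORBIT BOUND: the closed polynomial of any
labelled pattern expression with `k + l` labels over `ℂ` has, at every order `n`, a square-symmetric
circuit all of whose gate orbits have size `≤ (n+1)^(k+l+2)`, whatever the length of the expression.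
This is the third hypothesis of `orbitRestorationQP_of_narrowExpansion`
(`Theorems/MonotoneRestorationOrbitRestorationQPSplit.lean`), now a theorem. [folklore] -/
theorem stub_close_orbit : ∀ (n k l : ℕ) (e : PatternExpr ℂ k l),
    ∃ (G : Type) (_ : Fintype G) (C : LabelledArithCircuit ℂ (Fin n × Fin n) Unit G),
      C.IsSymmetric (Equiv.Perm (Fin n)) ∧ C.eval (C.output ()) = e.close n ∧
        C.orbitSize (Equiv.Perm (Fin n)) ≤ (n + 1) ^ (k + l + 2) :=
  fun n k l e => PatternClose.exists_symmetric_close_orbitSize_le n k l e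

end Summit.ValiantsHypothesis.ValiantsHypothesis.Theorems

end
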